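import Literature.NumberTheory.EllipticCurves.TwoIsogenySelmerGroupSha
import HarnessLib

/-!
# The `φ`-part of `Ш` from ANY rank certificate: `#(Ш(E_{a,b}/ℚ) ∩ im Ξ) · 2^{rank + 2} = 2^{dim₂ S'(a,b)} · #α(E_{a,b}(ℚ))`
# (Silverman, AEC, Thm. X.4.2(a) with Prop. X.4.9 and Silverman–Tate's `2^r = #α·#ᾱ/4`)

Topic `NumberTheory/EllipticCurves`. A bookkeeping consequence of two tree theorems of `TwoIsogenySelmerGroupSha` /
`TwoIsogenyDescentIndex` for `E = E_{a,b} = [0, a, 0, b, 0]` over `ℚ` (`b(a² − 4b) ≠ 0`), `E' = [0, −2a, 0, a² − 4b, 0]`: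

* `two_pow_twoIsogenySelmerRank'_eq_natCard_mul`: `2^{dim₂ S'(a,b)} = #ᾱ(E'(ℚ)) · #(Ш(E/ℚ) ∩ im Ξ)` (AEC X.4.2(a) counted:
  `0 → E'(ℚ)/φE(ℚ) → S^{(φ)}(E/ℚ) → Ш(E/ℚ)[φ] → 0`);
* `natCard_range_xSqClass_mul`: `#α(E(ℚ)) · #ᾱ(E'(ℚ)) = 2^{rank E(ℚ) + 2}` (Silverman–Tate §3.6).

Eliminating `#ᾱ(E'(ℚ))`: **`#(Ш(E/ℚ) ∩ im Ξ) · 2^{rank E(ℚ) + 2} = 2^{dim₂ S'(a,b)} · #α(E(ℚ))`**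
(`natCard_sha_inf_range_mul_two_pow`). So a LOWER bound for `dim₂ S'(a,b)` (everywhere-locally-soluble classes), a
LOWER bound for `#α(E(ℚ))` (rational points of `E`) and an UPPER bound for the rank obtained ANYWHERE in the isogeny class
(e.g. a sharp descent on another `2`-isogeny of `E'` when `E'` has full rational `2`-torsion; rank is an isogeny invariant)
give a lower bound for `#Ш(E/ℚ)[φ]` (`le_natCard_sha_inf_range_of_bounds`) — the «isogeny door» used for
`XCubeSub8XSqAddX*` (rank `0`) and `Curve346*` (rank `2`) of route ShaPrimaryTransfer. Theorems only; no named facts.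

## References

* [SilvermanAEC2009] J. H. Silverman, *AEC*, 2nd ed.: Thm. X.4.2(a), Prop. X.4.7, Prop. X.4.9, Prop. X.6.5(b).
* [SilvermanTate2015] J. H. Silverman, J. Tate, *Rational Points on Elliptic Curves*, §3.6 (`2^r = #α(Γ)·#ᾱ(Γ̄)/4`).
-/

noncomputable section

open scoped Classical

namespace Literature.NumberTheory.EllipticCurves

open _root_.WeierstrassCurve _root_.WeierstrassCurve.Affine

variable {a b : ℤ}

/-- **`#(Ш(E_{a,b}/ℚ) ∩ im Ξ) · 2^{rank + 2} = 2^{dim₂ S'(a,b)} · #α(E_{a,b}(ℚ))`** — Silverman's count of AEC X.4.2(a)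
(`2^{dim₂ S^{(φ)}} = #ᾱ(E'(ℚ))·#Ш(E)[φ]`) combined with Silverman–Tate's `#α·#ᾱ = 2^{rank+2}`.
[cite: SilvermanAEC2009, Thm. X.4.2(a) with Prop. X.4.9] [cite: SilvermanTate2015, §3.6 (2^r = #α(Γ)·#ᾱ(Γ̄)/4)] -/
theorem natCard_sha_inf_range_mul_two_pow (hab : b * (a ^ 2 - 4 * b) ≠ 0)
    [hE : (⟨0, (a : ℚ), 0, (b : ℚ), 0⟩ : WeierstrassCurve ℚ).IsElliptic] :
    Nat.card ↥((⟨0, (a : ℚ), 0, (b : ℚ), 0⟩ : WeierstrassCurve ℚ).sha ⊓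
        (⟨0, (a : ℚ), 0, (b : ℚ), 0⟩ : WeierstrassCurve ℚ).twoIsogenyTorsorHom.range) *
      2 ^ ((⟨0, (a : ℚ), 0, (b : ℚ), 0⟩ : WeierstrassCurve ℚ).mordellWeilRank + 2) =
    2 ^ twoIsogenySelmerRank' a b *
      Nat.card (Set.range (⟨0, (a : ℚ), 0, (b : ℚ), 0⟩ : WeierstrassCurve ℚ).xSqClass) := by
  have h1 := two_pow_twoIsogenySelmerRank'_eq_natCard_mul (a := a) (b := b) hab
  have h2 := (⟨0, (a : ℚ), 0, (b : ℚ), 0⟩ : WeierstrassCurve ℚ).natCard_range_xSqClass_mul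
  rw [twoIsogenyCodomain_mk_intCast] at h2
  rw [h1, ← h2]
  ring

/-- **The isogeny door, as an inequality**: if `dim₂ S'(a,b) ≥ σ` (everywhere-locally-soluble classes), `#α(E_{a,b}(ℚ)) ≥ 2^k`
(rational points) and `rank E_{a,b}(ℚ) ≤ r` (from anywhere in the isogeny class), then `#(Ш(E_{a,b}/ℚ) ∩ im Ξ) ≥ 2^{σ + k − r − 2}`;
in particular `Ш(E_{a,b}/ℚ)[φ] ≠ 0` as soon as `σ + k > r + 2`.
[cite: SilvermanAEC2009, Prop. X.6.5(b) (the method: Ш[φ] from locally trivial homogeneous spaces)] -/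
theorem le_natCard_sha_inf_range_of_bounds (hab : b * (a ^ 2 - 4 * b) ≠ 0)
    [hE : (⟨0, (a : ℚ), 0, (b : ℚ), 0⟩ : WeierstrassCurve ℚ).IsElliptic] {σ k r : ℕ}
    (hσ : σ ≤ twoIsogenySelmerRank' a b)
    (hk : 2 ^ k ≤ Nat.card (Set.range (⟨0, (a : ℚ), 0, (b : ℚ), 0⟩ : WeierstrassCurve ℚ).xSqClass))
    (hr : (⟨0, (a : ℚ), 0, (b : ℚ), 0⟩ : WeierstrassCurve ℚ).mordellWeilRank ≤ r) (hle : r + 2 ≤ σ + k) :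
    2 ^ (σ + k - (r + 2)) ≤ Nat.card ↥((⟨0, (a : ℚ), 0, (b : ℚ), 0⟩ : WeierstrassCurve ℚ).sha ⊓
        (⟨0, (a : ℚ), 0, (b : ℚ), 0⟩ : WeierstrassCurve ℚ).twoIsogenyTorsorHom.range) := by
  have key := natCard_sha_inf_range_mul_two_pow (a := a) (b := b) hab
  set N := Nat.card ↥((⟨0, (a : ℚ), 0, (b : ℚ), 0⟩ : WeierstrassCurve ℚ).sha ⊓
        (⟨0, (a : ℚ), 0, (b : ℚ), 0⟩ : WeierstrassCurve ℚ).twoIsogenyTorsorHom.range) with hN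
  set ρ := (⟨0, (a : ℚ), 0, (b : ℚ), 0⟩ : WeierstrassCurve ℚ).mordellWeilRank with hρ
  set A := Nat.card (Set.range (⟨0, (a : ℚ), 0, (b : ℚ), 0⟩ : WeierstrassCurve ℚ).xSqClass) with hA
  -- `N · 2^{ρ+2} = 2^{s'} · A ≥ 2^σ · 2^k`, and `2^{ρ+2} ≤ 2^{r+2}`
  have hlow : 2 ^ (σ + k) ≤ N * 2 ^ (ρ + 2) := by
    rw [key, pow_add]
    exact Nat.mul_le_mul (Nat.pow_le_pow_right (by norm_num) hσ) hk
  have hpow : 2 ^ (ρ + 2) ≤ 2 ^ (r + 2) := Nat.pow_le_pow_right (by norm_num) (by omega)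
  have h2 : 2 ^ (σ + k) ≤ N * 2 ^ (r + 2) := hlow.trans (Nat.mul_le_mul_left N hpow)
  have hsplit : 2 ^ (σ + k) = 2 ^ (σ + k - (r + 2)) * 2 ^ (r + 2) := by
    rw [← pow_add]; congr 1; omega
  rw [hsplit] at h2
  exact Nat.le_of_mul_le_mul_right h2 (pow_pos (by norm_num) _)

end Literature.NumberTheory.EllipticCurves

end
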